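import Literature.NumberTheory.EllipticCurves.KellerYin2024.AnomalousLambdaInvariants
import HarnessLib

/-!
# The anomalous anticyclotomic `λ`-congruence at a good Eisenstein prime GIVEN A FULL-DESCENT DATUM
# (Castella–Grossi–Lee–Skinner 2022 Thms. 2.2.1/2.2.2 ∘ Kriz 2016 Thm. 3 with Def. 31 (5), Thm. 34 (3) ∘ Hida 2010),
# every odd `p ∤ N` — in particular `p = 3`

Literature STATEMENT file: ONE `def … : Prop` (a named fact, D-0014) and THREE proved bookkeeping bridges (pure logic). Companion of
`AnomalousLambdaInvariants.lean`, whose three siblings it refines: `thm222_anacong_goodLattice_of_ne_one` (CGLS Thm. 2.2.2,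
`φ ≠ 𝟙`, published), `thm222_anacong_goodLattice_of_five_le` (`5 ≤ p`, composed of refereed print, ARM P referee C3
R428 Option B) and `thm222_anacong_goodLattice_OPEN` (every odd `p`, the Keller–Yin arXiv:2402.12781v2 Thm. 2.2.2 claim).
`thm222_anacong_goodLattice_of_fullDescentDatum` below is the body of the every-odd-`p` sibling byte for byte with ONE extra
hypothesis inserted after `Anom W p` — the FULL-DESCENT DATUM «`E` has a prime of additive reduction, or a prime `ℓ` of
multiplicative reduction that is split with `ℓ ≡ 1 (mod p)` or non-split with `ℓ + 1 ≡ 0 (mod p)`» (i.e. a multiplicative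
`ℓ` with `a_ℓ(E) ≡ ℓ (mod p)`). It is, token for token, the registered statement of stub 3a-A
`stub_anacongOfFullDescentDatum` of the crux-2 skeleton `Summits/BirchSwinnertonDyer/BirchSwinnertonDyer/Cruxes/
GoodLatticeBDPValue/Lines/halves.lean` (v21–v23; ideator bsd-idea-11 g9's typed AN-3 split, critic VERDICT #59 PASS); first
written as the cell candidate `Cruxes/GoodLatticeBDPValue/Lines/halves_3aA_literature_candidate.lean` (LEAD bsd-line-x1-p1 g5),
page-checked by LEAD g6 (`Lines/halves_3aA_pagecheck_leadg6.md`) and LEAD g7 (this filing).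

## Why this is a composition of refereed print (the `_of_five_le` species, one Kriz sentence swapped)

Kriz 2016 (ANT 10, pp. 309–374; arXiv:1512.05032): Assumptions 1 (§2.3, arXiv p. 8) are `k ≥ 2`, level `N > 4`, `p ∤ N`
ANY rational prime, `K` imaginary quadratic with ODD fundamental discriminant `D_K < −4` and `p` split, (Heeg) for `N`; the
Main Theorem (Thm. 3, p. 8) reads «Suppose `f` has Eisenstein descent of type `(ψ₁,ψ₂,N₊,N₋,N₀)` mod `𝔪` … for all
`χ ∈ Σ̂_cc(𝔑)` we have `𝓛_p(f,χ) ≡ ψ₁⁻¹(D_K)·(… · Ξ · L_p(ψ_{1/K}χ⁻¹,0))² (mod 𝔪)`» — the BDP / Katz congruence, with NO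
condition `p > 3`. Def. 31 (p. 20): partial Eisenstein descent of type `(ψ₁,ψ₂,N₊,N₋,N₀)` = conditions (1)–(4) on the
`a_ℓ`; FULL descent = (1)–(4) and (5)
`δ_{ψ₁=1}·(B_{1,ψ₂}B_{k,ψ₁}/k)·∏_{ℓ∣N₊}(1−ψ₁(ℓ)ℓ^{k−1})·∏_{ℓ∣N₋}(1−ψ₂(ℓ))·∏_{ℓ∣N₀}(1−ψ₁(ℓ)ℓ^{k−1})(1−ψ₂(ℓ)) ≡ 0 (mod 𝔪)`;
Rem. 32: full descent ⟺ `θ^j f ≡ θ^j E_k^{ψ₁,ψ₂,(N)}` for all `j ≥ 0`. Thm. 34 (3) (pp. 21–22; with Thm. 35 for `E/ℚ`, `k = 2`,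
`M = ℚ_p`, `𝔪 = p`): if `ρ̄_f` is reducible then `f` has partial descent of type `(ψ₁,ψ₂,N₊,N₋,N₀)` where «`N₋` [is] ANY product
of `ℓ ∥ N` satisfying `a_ℓ ≡ ψ₂(ℓ)ℓ^{k−1} (mod λ)`» and `N₀` is the squarefull part of `N`; Thm. 34 (2): a non-split
multiplicative `ℓ` so placed has `ℓ + 1 ≡ 0`. Rem. 33 (pp. 20–21): if `ψ₁ ≠ 𝟙` then `δ = 0` and (5) holds; if `ψ₁ = 𝟙` and `k`
is even then `B_{1,ψ₂} = 0` unless `ψ₂ = 𝟙`; if `ψ₁ = ψ₂ = 𝟙` then «(5) is still forced to hold unless `N₋N₀ = 1`» (the factor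
`(1 − ψ₂(ℓ))`, `ℓ ∣ N₋N₀`, vanishes identically — a `p`-FREE sentence); ONLY the residual sub-case `N₋N₀ = 1` uses «Suppose
`p > k + 1`, so that by [Serre] `θ` is injective» — the sentence that stops `_of_five_le` at `5 ≤ p`. The datum of this
declaration says exactly: `N₀ > 1` (an additive prime), or a multiplicative `ℓ` with `a_ℓ ≡ ℓ = ψ₂(ℓ)ℓ^{k−1} (mod p)` exists
and may be placed in `N₋` (Thm. 34 (3): «any product»), so `N₋N₀ > 1` and (5) reads `0 ≡ 0` in EVERY labelling `(ψ₁,ψ₂)` of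
`E[p]^{ss}` and at EVERY `p ∤ N`, including `p = 3`: `f_E` has FULL Eisenstein descent, Kriz's Main Theorem applies, and —
as for `_of_five_le` — the printed proofs of CGLS Thm. 2.2.1 (whose hypothesis «`φ ≠ 𝟙`» is used at exactly one line, the
congruence of forms `f ≡ G (mod p)` (eq:cong-mf), arXiv:2008.02571v2 TeX L1075–1078, i.e. full descent) and Thm. 2.2.2
(Hida's `μ = 0` at L1132; the Katz functional equation (2.16) = Kriz Thm. 27 at L1148–1151) run verbatim. For `φ ≠ 𝟙` the
statement is implied by the published sibling `_of_ne_one`, for `5 ≤ p` by `_of_five_le`; the new content is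
`(p, φ) = (3, 𝟙)` GIVEN the datum. (Not used here: by the tree theorem
`Summit.BirchSwinnertonDyer.BirchSwinnertonDyer.Theorems.GoodLatticeBDPValueFullDescentStub.stub_fullDescentAtThreeOfRed`,
LEAD g5 p658450, unconditional, the datum ALWAYS exists when `3` is a good prime with `E[3]` reducible.)

## Status / honest framing

Named fact (D-0014): a `Prop`, nothing asserted; no `sorry`, no instance, no notation. LABEL AT FILING: «composed of refereed
print» is the FILER'S reading (three LEAD page-checks, locators above); the ARM P referee C3's ruling on this composition
(cell bsd-eis, pub-bsdpct INBOX 2026-08-28 l.904/911/912) is PENDING and governs any relabel (statement bytes would not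
change). Consumers (crux 2 `GoodLatticeBDPValue`, stub 3a-A) re-point by their owners. NEVER cite this `Prop` as a theorem.
No summit statement, no case of BSD, no Keller–Yin theorem is proved by this file.

## References

* D. Kriz, *Generalized Heegner cycles at Eisenstein primes and the Katz p-adic L-function*, Algebra Number Theory 10 (2016)
  309–374 — Assumptions 1 and Thm. 3 (arXiv:1512.05032 p. 8), Def. 31 with (5), Rem. 32, Rem. 33 (pp. 20–21), Thm. 34 (2)(3),
  Thm. 35 (pp. 21–22), Thm. 27.
* F. Castella, G. Grossi, J. Lee, C. Skinner, *On the anticyclotomic Iwasawa theory of rational elliptic curves at Eisenstein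
  primes*, Invent. Math. 227 (2022) — Thms. 2.2.1, 2.2.2 with (2.16) and their proofs (arXiv:2008.02571v2 TeX L1051–1153).
* H. Hida, *The Iwasawa μ-invariant of p-adic Hecke L-functions*, Ann. of Math. 172 (2010), Thm. I.
* T. Keller, M. Yin, arXiv:2402.12781v2, Thm. 2.2.2 (statement shape only).
-/

open scoped Classical

open WeierstrassCurve NumberField IsDedekindDomain Field Polynomial
  Literature.NumberTheory.EllipticCurves Literature.NumberTheory.EllipticCurves.ModularForms
  Literature.NumberTheory.QuadraticFields Literature.NumberTheory.EllipticCurves.Rank1Residual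
  Literature.NumberTheory.EllipticCurves.Castella2018 Literature.NumberTheory.EllipticCurves.GreenbergSelmer
  Literature.NumberTheory.EllipticCurves.GreenbergVatsal2000 Literature.NumberTheory.GaloisRepresentations
  Literature.NumberTheory.EllipticCurves.CastellaGrossiLeeSkinner2022

namespace Literature.NumberTheory.EllipticCurves.KellerYin2024

/-- **Castella–Grossi–Lee–Skinner 2022 Thms. 2.2.1/2.2.2 with (2.16) ∘ Kriz 2016 (Thm. 3 = Main Theorem under Assumptions 1;
Def. 31 with (5); Rem. 32; Rem. 33; Thm. 34 (2)(3); Thm. 35) ∘ Hida 2010 Thm. I: the anomalous-congruence good-lattice ANALYTIC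
statement WITHOUT «`φ ≠ 𝟙`», at EVERY odd `p`, GIVEN A FULL-DESCENT DATUM — composed of refereed print (filer's reading;
referee C3 ruling pending, see the module docstring).** Statement: the body of `thm222_anacong_goodLattice_OPEN` byte for byte
with the extra hypothesis, inserted after `Anom W p`,
«`(∃ ℓ prime, Addv W ℓ) ∨ (∃ ℓ prime, W.HasMultiplicativeReductionAtPrime ℓ ∧ ((W.HasSplitMultiplicativeReductionAtPrime ℓ
∧ ℓ ≡ 1 [MOD p]) ∨ (¬ W.HasSplitMultiplicativeReductionAtPrime ℓ ∧ ℓ + 1 ≡ 0 [MOD p])))`» (an additive prime: Kriz's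
`N₀ > 1`; a multiplicative `ℓ` with `a_ℓ ≡ ℓ (mod p)`: placed in `N₋` by Thm. 34 (3)). WHY PRINT: under the datum condition
(5) of Def. 31 holds identically (Rem. 33: `ψ₁ ≠ 𝟙 ⇒ δ = 0`; `ψ₁ = ψ₂ = 𝟙 ⇒` the factor `(1 − ψ₂(ℓ))`, `ℓ ∣ N₋N₀`, is `0`),
so `f_E` has FULL Eisenstein descent (Thm. 35 + Thm. 34 (3) give the partial one) at every `p ∤ N` — Assumptions 1 carry no
`p > 3` —, the congruence of forms `f ≡ E₂^{ψ₁,ψ₂,(N)}` holds for `j ≥ 0` (Rem. 32), Kriz's Main Theorem gives the BDP / Katz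
congruence, and CGLS's printed proofs of Thms. 2.2.1 ((eq:cong-mf) is their only use of «`φ ≠ 𝟙`») and 2.2.2 (Hida `μ = 0`,
(2.16) = Kriz Thm. 27) run verbatim for every `p > 2`, INCLUDING `p = 3`. The sibling `_of_five_le` is the same composition
with Rem. 33's «`p > k + 1`» sentence in place of the datum; `_of_ne_one` covers `φ ≠ 𝟙`; the new content is
`(p, φ) = (3, 𝟙)` with a datum. This is the registered statement of stub 3a-A `stub_anacongOfFullDescentDatum` of
`Cruxes/GoodLatticeBDPValue/Lines/halves.lean` (v21–v23), token for token. Named fact (D-0014): nothing asserted.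
[cite: Kriz2016, Thm. 3 (Main Theorem) with Assumptions 1 (arXiv:1512.05032 p. 8); Def. 31 with (5), Rem. 32, Rem. 33 (first part: ψ₁ ≠ 𝟙 ⇒ (5); ψ₁ = ψ₂ = 𝟙 ⇒ «(5) is still forced to hold unless N₋N₀ = 1») (pp. 20–21); Thm. 34 (2)(3), Thm. 35 (pp. 21–22); Thm. 27 — ANT 10 (2016) 309–374]
[cite: CastellaGrossiLeeSkinner2022, Thm. 2.2.1 (thm:kriz) and its proof ((eq:cong-mf) «By [Kriz] … f ≡ G»), Thm. 2.2.2 (cor:Kriz) with (2.16) (arXiv:2008.02571v2 TeX L1051–1153; Invent. Math. 227 (2022) §2.2)]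
[cite: Hida2010MuInvariant, Thm. I (μ = 0, as used in CGLS's proof of Thm. 2.2.2)]
[cite: KellerYin2024, Thm. 2.2.2 (anacong; arXiv:2402.12781v2 TeX L1445–1448) — the statement's SHAPE only; no step of the preprint is used] -/
def thm222_anacong_goodLattice_of_fullDescentDatum : Prop :=
  ∀ (W : WeierstrassCurve ℚ) [W.IsElliptic] [W.IsGloballyMinimal] (p : ℕ) [Fact p.Prime],
    2 < p → Good W p → Red W p → Anom W p →
    ((∃ (ℓ : ℕ) (hℓ : ℓ.Prime), haveI : Fact ℓ.Prime := ⟨hℓ⟩; Addv W ℓ) ∨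
      (∃ (ℓ : ℕ) (hℓ : ℓ.Prime), haveI : Fact ℓ.Prime := ⟨hℓ⟩;
        W.HasMultiplicativeReductionAtPrime ℓ ∧
          ((W.HasSplitMultiplicativeReductionAtPrime ℓ ∧ ℓ ≡ 1 [MOD p]) ∨
            (¬ W.HasSplitMultiplicativeReductionAtPrime ℓ ∧ ℓ + 1 ≡ 0 [MOD p])))) →
    (∀ Φ : AddSubgroup (geomTorsion W (p : ℤ)), IsRationalLine W p Φ → ¬ LineUnramifiedAt W p Φ) →
    ∀ (K : Type) [Field K] [NumberField K], IsImaginaryQuadratic K →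
      SatisfiesHeegnerHypothesis (W.conductorNorm ℤ) K → SatisfiesHeegnerHypothesis p K →
      Odd (NumberField.discr K) → NumberField.discr K ≠ -3 →
      (∀ Q : (W.baseChange K).toAffine.Point, p • Q = 0 → Q = 0) →
    ∀ (ι : K →+* ℚ_[p]) (v vbar : HeightOneSpectrum (𝓞 K)),
      (∀ x : 𝓞 K, x ∈ v.asIdeal ↔ ‖ι (x : K)‖ < 1) →
      ((p : ℕ) : 𝓞 K) ∈ vbar.asIdeal → vbar ≠ v →
    ∀ (κ : ZpExtension K p), κ.IsAnticyclotomic →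
    ∀ (γ : absoluteGaloisGroup K) [Fact (κ.IsTopGenerator γ)],
    ∀ (N : ℕ) [NeZero N] (Dt : ModularParametrizationData W N),
    ∀ (ι' : PadicAlgCl p ≃+* ℂ),
      (∀ (w : InfinitePlace K) (k : 𝓞 K), k ∈ v.asIdeal ↔ ‖ι'.symm (w.embedding (k : K))‖ < 1) →
    ∀ (ΩK : ℂ) (Ωp : (unrIntegers p)ˣ) (L : UnrSeries p), ΩK ≠ 0 →
      IsBDPLFunction ι' v κ γ Dt.f ΩK ((Ωp : unrIntegers p) : ℂ_[p]) L →
    ∀ (θsub θquot : FramedGaloisRep K (padicCoeffIntegers (∅ : Set (PadicAlgCl p))) 1),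
      IsResidualPairOver (W.baseChange K) p θsub θquot →
    ∀ (Sf : Finset (HeightOneSpectrum (𝓞 K))),
      (∀ w : HeightOneSpectrum (𝓞 K), w ∈ Sf ↔ ((W.conductorNorm ℤ : ℤ) : 𝓞 K) ∈ w.asIdeal) →
    ∀ (θK : HeckeCharacter K), IsHeckeCharOf ι' θquot θK →
    ∀ (Cbar : Finset (HeightOneSpectrum (𝓞 K))), (∀ u ∈ Cbar, ¬ θK.IsUnramifiedAt u) →
    ∀ (ΩK' : ℂ) (Ωp' : (unrIntegers p)ˣ) (Lφ : UnrSeries p), ΩK' ≠ 0 →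
      IsKatzLFunction ι' v vbar Cbar κ γ θK ΩK' ((Ωp' : unrIntegers p) : ℂ_[p]) Lφ →
    ∃ n nφ : ℕ, FirstUnitCoeffAt L n ∧ FirstUnitCoeffAt Lφ nφ ∧
      n + ∑ w ∈ Sf, curveLocalLambda κ (W.baseChange K) w =
        2 * nφ + ∑ w ∈ Sf, (charLocalLambda ∅ κ θsub w + charLocalLambda ∅ κ θquot w)

/-- **Bridge, PROVED (bookkeeping)**: the every-odd-`p` sibling `thm222_anacong_goodLattice_OPEN` (Keller–Yin Thm. 2.2.2 as
claimed) implies the full-descent-datum statement (one hypothesis dropped). No content.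
[cite: KellerYin2024, Thm. 2.2.2 (arXiv:2402.12781v2 TeX L1445–1448)] -/
theorem thm222_anacong_goodLattice_OPEN.of_fullDescentDatum (h : thm222_anacong_goodLattice_OPEN) :
    thm222_anacong_goodLattice_of_fullDescentDatum :=
  fun W _ _ p _ hp hgood hred hanom _ hlat K _ _ hK hH hHp hodd hd3 htor ι v vbar hv hvbar hne κ hκ γ _
      N _ Dt ι' hι' ΩK Ωp L hΩ hL θsub θquot hpair Sf hSf θK hθK Cbar hC ΩK' Ωp' Lφ hΩ' hLφ ↦
    h W p hp hgood hred hanom hlat K hK hH hHp hodd hd3 htor ι v vbar hv hvbar hne κ hκ γ N Dt ι' hι'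
      ΩK Ωp L hΩ hL θsub θquot hpair Sf hSf θK hθK Cbar hC ΩK' Ωp' Lφ hΩ' hLφ

/-- **Bridge, PROVED (bookkeeping)**: at `5 ≤ p` the full-descent-datum statement is implied by the composed-print sibling
`thm222_anacong_goodLattice_of_five_le` (the datum is discarded). No content.
[cite: CastellaGrossiLeeSkinner2022, Thm. 2.2.2 (cor:Kriz) with (2.16)] [cite: Kriz2016, Rem. 33] -/
theorem thm222_anacong_goodLattice_of_five_le.of_fullDescentDatum_five_le (h : thm222_anacong_goodLattice_of_five_le) :
    ∀ (W : WeierstrassCurve ℚ) [W.IsElliptic] [W.IsGloballyMinimal] (p : ℕ) [Fact p.Prime],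
      5 ≤ p → Good W p → Red W p → Anom W p →
      ((∃ (ℓ : ℕ) (hℓ : ℓ.Prime), haveI : Fact ℓ.Prime := ⟨hℓ⟩; Addv W ℓ) ∨
        (∃ (ℓ : ℕ) (hℓ : ℓ.Prime), haveI : Fact ℓ.Prime := ⟨hℓ⟩;
          W.HasMultiplicativeReductionAtPrime ℓ ∧
            ((W.HasSplitMultiplicativeReductionAtPrime ℓ ∧ ℓ ≡ 1 [MOD p]) ∨
              (¬ W.HasSplitMultiplicativeReductionAtPrime ℓ ∧ ℓ + 1 ≡ 0 [MOD p])))) →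
      (∀ Φ : AddSubgroup (geomTorsion W (p : ℤ)), IsRationalLine W p Φ → ¬ LineUnramifiedAt W p Φ) →
      ∀ (K : Type) [Field K] [NumberField K], IsImaginaryQuadratic K →
        SatisfiesHeegnerHypothesis (W.conductorNorm ℤ) K → SatisfiesHeegnerHypothesis p K →
        Odd (NumberField.discr K) → NumberField.discr K ≠ -3 →
        (∀ Q : (W.baseChange K).toAffine.Point, p • Q = 0 → Q = 0) →
      ∀ (ι : K →+* ℚ_[p]) (v vbar : HeightOneSpectrum (𝓞 K)),
        (∀ x : 𝓞 K, x ∈ v.asIdeal ↔ ‖ι (x : K)‖ < 1) →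
        ((p : ℕ) : 𝓞 K) ∈ vbar.asIdeal → vbar ≠ v →
      ∀ (κ : ZpExtension K p), κ.IsAnticyclotomic →
      ∀ (γ : absoluteGaloisGroup K) [Fact (κ.IsTopGenerator γ)],
      ∀ (N : ℕ) [NeZero N] (Dt : ModularParametrizationData W N),
      ∀ (ι' : PadicAlgCl p ≃+* ℂ),
        (∀ (w : InfinitePlace K) (k : 𝓞 K), k ∈ v.asIdeal ↔ ‖ι'.symm (w.embedding (k : K))‖ < 1) →
      ∀ (ΩK : ℂ) (Ωp : (unrIntegers p)ˣ) (L : UnrSeries p), ΩK ≠ 0 →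
        IsBDPLFunction ι' v κ γ Dt.f ΩK ((Ωp : unrIntegers p) : ℂ_[p]) L →
      ∀ (θsub θquot : FramedGaloisRep K (padicCoeffIntegers (∅ : Set (PadicAlgCl p))) 1),
        IsResidualPairOver (W.baseChange K) p θsub θquot →
      ∀ (Sf : Finset (HeightOneSpectrum (𝓞 K))),
        (∀ w : HeightOneSpectrum (𝓞 K), w ∈ Sf ↔ ((W.conductorNorm ℤ : ℤ) : 𝓞 K) ∈ w.asIdeal) →
      ∀ (θK : HeckeCharacter K), IsHeckeCharOf ι' θquot θK →
      ∀ (Cbar : Finset (HeightOneSpectrum (𝓞 K))), (∀ u ∈ Cbar, ¬ θK.IsUnramifiedAt u) →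
      ∀ (ΩK' : ℂ) (Ωp' : (unrIntegers p)ˣ) (Lφ : UnrSeries p), ΩK' ≠ 0 →
        IsKatzLFunction ι' v vbar Cbar κ γ θK ΩK' ((Ωp' : unrIntegers p) : ℂ_[p]) Lφ →
      ∃ n nφ : ℕ, FirstUnitCoeffAt L n ∧ FirstUnitCoeffAt Lφ nφ ∧
        n + ∑ w ∈ Sf, curveLocalLambda κ (W.baseChange K) w =
          2 * nφ + ∑ w ∈ Sf, (charLocalLambda ∅ κ θsub w + charLocalLambda ∅ κ θquot w) :=
  fun W _ _ p _ hp hgood hred hanom _ hlat K _ _ hK hH hHp hodd hd3 htor ι v vbar hv hvbar hne κ hκ γ _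
      N _ Dt ι' hι' ΩK Ωp L hΩ hL θsub θquot hpair Sf hSf θK hθK Cbar hC ΩK' Ωp' Lφ hΩ' hLφ ↦
    h W p hp hgood hred hanom hlat K hK hH hHp hodd hd3 htor ι v vbar hv hvbar hne κ hκ γ N Dt ι' hι'
      ΩK Ωp L hΩ hL θsub θquot hpair Sf hSf θK hθK Cbar hC ΩK' Ωp' Lφ hΩ' hLφ

/-- **The every-odd-`p` sibling from its two slices with the datum as a HYPOTHESIS at `p = 3`, PROVED (pure logic)**: an
odd prime is `3` or `≥ 5`; at `5 ≤ p` use `thm222_anacong_goodLattice_of_five_le`, at `p = 3` use the full-descent-datum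
statement fed with a datum supplied by the caller (in the tree: the unconditional theorem
`Summit.…Theorems.GoodLatticeBDPValueFullDescentStub.stub_fullDescentAtThreeOfRed`, which Literature may not import). This is
the shape in which the crux-2 line `halves` consumes the two composed-print facts. No content beyond case analysis.
[cite: CastellaGrossiLeeSkinner2022, Thms. 2.2.1/2.2.2 with (2.16)] [cite: Kriz2016, Def. 31 (5), Rem. 33, Thm. 34 (3), Thm. 35] -/
theorem thm222_anacong_goodLattice_OPEN_of_fullDescentDatum_of_five_le
    (h3 : thm222_anacong_goodLattice_of_fullDescentDatum) (h5 : thm222_anacong_goodLattice_of_five_le)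
    (hdatum : ∀ (W : WeierstrassCurve ℚ) [W.IsElliptic] [W.IsGloballyMinimal],
      Good W 3 → Red W 3 →
      ((∃ (ℓ : ℕ) (hℓ : ℓ.Prime), haveI : Fact ℓ.Prime := ⟨hℓ⟩; Addv W ℓ) ∨
        (∃ (ℓ : ℕ) (hℓ : ℓ.Prime), haveI : Fact ℓ.Prime := ⟨hℓ⟩;
          W.HasMultiplicativeReductionAtPrime ℓ ∧
            ((W.HasSplitMultiplicativeReductionAtPrime ℓ ∧ ℓ ≡ 1 [MOD 3]) ∨
              (¬ W.HasSplitMultiplicativeReductionAtPrime ℓ ∧ ℓ + 1 ≡ 0 [MOD 3]))))) :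
    thm222_anacong_goodLattice_OPEN := by
  intro W _ _ p _ hp hgood hred hanom hlat K _ _ hK hH hHp hodd hd3 htor ι v vbar hv hvbar hvne κ hκ γ _
    N _ Dt ι' hι' ΩK Ωp L hΩ hL θsub θquot hpair Sf hSf θK hθK Cbar hC ΩK' Ωp' Lφ hΩ' hLφ
  by_cases h5le : 5 ≤ p
  · exact h5 W p h5le hgood hred hanom hlat K hK hH hHp hodd hd3 htor ι v vbar hv hvbar hvne κ hκ γ N Dt
      ι' hι' ΩK Ωp L hΩ hL θsub θquot hpair Sf hSf θK hθK Cbar hC ΩK' Ωp' Lφ hΩ' hLφ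
  · have hp3 : p = 3 := by
      rcases (show p = 3 ∨ p = 4 by omega) with h | h
      · exact h
      · exact absurd (Fact.out : p.Prime) (by rw [h]; decide)
    subst hp3
    exact h3 W 3 hp hgood hred hanom (hdatum W hgood hred) hlat K hK hH hHp hodd hd3 htor ι v vbar hv hvbar hvne κ
      hκ γ N Dt ι' hι' ΩK Ωp L hΩ hL θsub θquot hpair Sf hSf θK hθK Cbar hC ΩK' Ωp' Lφ hΩ' hLφ

end Literature.NumberTheory.EllipticCurves.KellerYin2024
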